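import Summits.BirchSwinnertonDyer.BirchSwinnertonDyer.Theses.LeadingTerm
import Literature.NumberTheory.EllipticCurves.ComplexMultiplicationRationalJIntegralProofs
import Literature.NumberTheory.EllipticCurves.SzpiroLocalDataProofs
import Literature.NumberTheory.EllipticCurves.DegreeConjectureAbcPrelims

/-!
# `LeadingTerm.TamePinchR` (crux stmt-BirchSwinnertonDyer-17007, route `LeadingTerm`):
# degenerate-case content and non-vacuity (negative-side support, refuter crux-attack seat;
# this file does NOT refute the crux)

Write `S` for the crux `TamePinchR`: every NON-CM elliptic `E/ℚ` (globally minimal `W`) has an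
admissible prime `p ≥ 5` (good ordinary, `ρ̄_{E,p}` onto `GL₂(𝔽_p)`), a newform `f` of `W`, and a
square-free product `n` of `r = rank_ℤ E(ℚ)` Kolyvagin primes `ℓ` (`ℓ ∤ Np`, `ℓ ≡ 1`,
`a_ℓ ≡ 2 (mod p)`) whose mod-`p` Kurihara number
`δ_n = ∑_{a ∈ (ℤ/n)ˣ} [a/n]⁺_f · ∏_{ℓ ∣ n} ψ_ℓ(a)` is non-zero for some surjective discrete
logarithms `ψ_ℓ : (ℤ/ℓ)ˣ → ℤ/p` (C.-H. Kim, arXiv:2203.12159, §1.4.3 and Thm. 1.11).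

Sorry-free content:

* `kuriharaSum_one` — at `n = 1` the certificate sum is the single term `[0]⁺_f` cast to `ZMod p`
  (the sum over `(ZMod 1)ˣ` has one term, `a.val = 0`, the product over `∅` is `1`): the
  RANK-ZERO degenerate instance of `S` reads `([0]⁺_f : ZMod p) ≠ 0`.
* `ratPlusSymbol_zero_ne_zero_of_tamePinchR` — hence `S ⇒` for every non-CM globally minimal
  elliptic `W` with `rank_ℤ W(ℚ) = 0` there are an admissible `p` and a newform `f` of `W` with
  `([0]⁺_f : ZMod p) ≠ 0`, in particular `[0]⁺_f ≠ 0`, i.e. (`[0]⁺ = L(f,1)/Ω⁺_f`,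
  Mazur–Tate–Teitelbaum §I.8; Kim §1.4.3 `δ₁ = L(E,1)/Ω⁺_E`) `L(E, 1) ≠ 0`: on rank-`0` curves
  `S` carries the open rank-zero converse `rank = 0 ⇒ r_an = 0` (the rank-`0`, non-CM case of the
  route's lower-bound conjunct `L^{(r)}(E,1) ≠ 0`) plus the `p`-adic unit statement of BSD(p).
* `modularity_of_tamePinchR`, `exists_admissible_of_tamePinchR` — `S ⇒` every non-CM globally
  minimal elliptic `W` is modular (`∃ f, IsNewformOf W f`, BCDT 2001) and has a good ordinary
  prime `p ≥ 5` of surjective mod-`p` image (Serre 1972 + Serre 1981 density; theorems in print,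
  named facts / absent in the tree): what any proof must deliver first.
* `hypotheses_satisfiable` (with `isGloballyMinimal_thirtySevenA1`, `not_hasCM_thirtySevenA1`) — NON-VACUITY of the repaired binder: `y² + y = x³ − x` (Cremona 37a1,
  `Δ = 37`, `j = 110592/37 = 2¹²·3³/37`) is elliptic, globally minimal (`q¹² ∤ 37`) and has no
  complex multiplication, by the tree theorem `WeierstrassCurve.not_hasCM_of_one_lt_norm_j`
  (`‖j‖₃₇ = 37 > 1`; CM `j`-invariants are integral, Silverman ATAEC II.6.1). So the rev-6
  hypothesis `¬ W.HasCM` excludes the refuted CM witness 32a2 without emptying the binder.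
* `ratCast_one_div_five_zmod_five` — the typing caveat of the certificate: the `ℚ → ZMod p` cast
  is `num/den` with `x/0 = 0`, so a symbol `[a/n]⁺` with `p ∣ den` is silently `0`
  (e.g. `((1/5 : ℚ) : ZMod 5) = 0`); harmless only because `p` is existentially quantified
  (Kim §1.4.1: `[a/n]⁺ ∈ ℤ_(p)` once `ρ̄` is irreducible and the Manin constant is prime to `p`).
-/

noncomputable section

-- D-0017: single-problem summit, so `Summit.BirchSwinnertonDyer.BirchSwinnertonDyer.…` repeats a
-- namespace BY DESIGN.
set_option linter.dupNamespace false

namespace Summit.BirchSwinnertonDyer.BirchSwinnertonDyer.Theorems.TamePinchR.Negative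

open scoped MatrixGroups ModularForm
open CongruenceSubgroup Literature.NumberTheory.EllipticCurves
  Literature.NumberTheory.EllipticCurves.ModularForms
open Summit.BirchSwinnertonDyer.BirchSwinnertonDyer.Theses
open WeierstrassCurve

/-! ### The rank-zero degenerate instance: `n = 1` -/

/-- At `n = 1` the Kurihara certificate sum of `TamePinchR` is `[0]⁺_f` cast to `ZMod p`: the
sum over `(ZMod 1)ˣ` has the single term `a = 1 = 0` (`a.val = 0`), and the product over the
(empty) prime factors of `1` is `1` (Kim, arXiv:2203.12159, §1.4.3: `δ₁ = [0]⁺`). [folklore] -/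
theorem kuriharaSum_one (p : ℕ) [Fact p.Prime] {N : ℕ} [NeZero N] (f : CuspForm (Gamma0 N) 2)
    (ψ : (ℓ : ℕ) → (ZMod ℓ)ˣ →* Multiplicative (ZMod p)) :
    (∑ a : (ZMod 1)ˣ, (ratPlusSymbol f (((a : ZMod 1).val : ℚ) / (1 : ℕ)) : ZMod p) *
        ∏ ℓ ∈ (1 : ℕ).primeFactors.attach,
          Multiplicative.toAdd (ψ ℓ.1 (ZMod.unitsMap (Nat.dvd_of_mem_primeFactors ℓ.2) a)))
      = (ratPlusSymbol f 0 : ZMod p) := by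
  have hatt : (1 : ℕ).primeFactors.attach = ∅ :=
    Finset.attach_eq_empty_iff.mpr Nat.primeFactors_one
  haveI : Subsingleton (ZMod 1) := ZMod.subsingleton_iff.mpr rfl
  rw [hatt, Fintype.sum_unique]
  have hx : ((default : (ZMod 1)ˣ) : ZMod 1) = 0 := Subsingleton.elim _ _
  simp [hx]

/-- `TamePinchR ⇒` at a NON-CM curve of Mordell–Weil rank `0` there are an admissible prime `p`
(good ordinary `≥ 5`, surjective mod-`p` image) and a newform `f` of `W` with
`([0]⁺_f : ZMod p) ≠ 0`: the only square-free `n` with no prime factor is `n = 1`, and the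
certificate collapses to its `n = 1` instance (`kuriharaSum_one`). [folklore] -/
theorem ratCast_ratPlusSymbol_zero_ne_zero_of_tamePinchR (h : LeadingTerm.TamePinchR)
    (W : WeierstrassCurve ℚ) [W.IsElliptic] [W.IsGloballyMinimal] (hCM : ¬ W.HasCM)
    (h0 : W.mordellWeilRank = 0) :
    ∃ (p : ℕ) (_ : Fact p.Prime), 5 ≤ p ∧ IsOrdinaryAt W p ∧ W.HasSurjectiveModNGaloisRep (p : ℤ) ∧
      ∃ (N : ℕ) (_ : NeZero N) (f : CuspForm (Gamma0 N) 2), IsNewformOf W f ∧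
        (ratPlusSymbol f 0 : ZMod p) ≠ 0 := by
  obtain ⟨p, hp, h5, hord, hsurj, N, hN, f, hf, n, hn, -, hcard, -, ψ, -, hsum⟩ := h W hCM
  refine ⟨p, hp, h5, hord, hsurj, N, hN, f, hf, ?_⟩
  have hn1 : n = 1 := by
    rw [h0, Finset.card_eq_zero, Nat.primeFactors_eq_empty] at hcard
    exact hcard.resolve_left hn.out
  subst hn1
  rwa [kuriharaSum_one] at hsum

/-- `TamePinchR ⇒` every NON-CM globally minimal elliptic `W/ℚ` of Mordell–Weil rank `0` has a
newform `f` with `[0]⁺_f ≠ 0` — i.e. `L(f, 1) = [0]⁺_f · Ω⁺_f ≠ 0` (Mazur–Tate–Teitelbaum §I.8),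
the open rank-zero converse `rank_ℤ E(ℚ) = 0 ⇒ ord_{s=1} L(E,s) = 0` restricted to non-CM curves:
on rank-`0` curves the crux restates the rank-`0` case of the route's lower-bound conjunct.
[folklore] -/
theorem ratPlusSymbol_zero_ne_zero_of_tamePinchR (h : LeadingTerm.TamePinchR)
    (W : WeierstrassCurve ℚ) [W.IsElliptic] [W.IsGloballyMinimal] (hCM : ¬ W.HasCM)
    (h0 : W.mordellWeilRank = 0) :
    ∃ (N : ℕ) (_ : NeZero N) (f : CuspForm (Gamma0 N) 2), IsNewformOf W f ∧
      ratPlusSymbol f 0 ≠ 0 := by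
  obtain ⟨p, hp, -, -, -, N, hN, f, hf, hne⟩ :=
    ratCast_ratPlusSymbol_zero_ne_zero_of_tamePinchR h W hCM h0
  refine ⟨N, hN, f, hf, fun h0' ↦ hne ?_⟩
  rw [h0', Rat.cast_zero]

/-- `TamePinchR ⇒` every NON-CM globally minimal elliptic `W/ℚ` is modular: the crux carries the
modularity theorem (BCDT 2001; the tree's named fact `exists_isNewformOf`). [folklore] -/
theorem modularity_of_tamePinchR (h : LeadingTerm.TamePinchR) (W : WeierstrassCurve ℚ)
    [W.IsElliptic] [W.IsGloballyMinimal] (hCM : ¬ W.HasCM) :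
    ∃ (N : ℕ) (_ : NeZero N) (f : CuspForm (Gamma0 N) 2), IsNewformOf W f := by
  obtain ⟨-, -, -, -, -, N, hN, f, hf, -⟩ := h W hCM
  exact ⟨N, hN, f, hf⟩

/-- `TamePinchR ⇒` every NON-CM globally minimal elliptic `W/ℚ` has a good ordinary prime
`p ≥ 5` with surjective mod-`p` Galois image (in print: Serre 1972 open image + density one of
ordinary primes for non-CM curves, Serre 1981; exactly what fails for CM curves, cf. the refuted
`TamePinch`). [folklore] -/
theorem exists_admissible_of_tamePinchR (h : LeadingTerm.TamePinchR) (W : WeierstrassCurve ℚ)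
    [W.IsElliptic] [W.IsGloballyMinimal] (hCM : ¬ W.HasCM) :
    ∃ (p : ℕ) (_ : Fact p.Prime), 5 ≤ p ∧ IsOrdinaryAt W p ∧
      W.HasSurjectiveModNGaloisRep (p : ℤ) := by
  obtain ⟨p, hp, h5, hord, hsurj, -⟩ := h W hCM
  exact ⟨p, hp, h5, hord, hsurj⟩

/-! ### The cast caveat -/

/-- The `ℚ → ZMod p` cast is `num / den` with Lean's `x / 0 = 0`: a rational whose denominator
is divisible by `p` is sent to `0`. Instance: `((1/5 : ℚ) : ZMod 5) = 0`. [folklore] -/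
theorem ratCast_one_div_five_zmod_five [Fact (Nat.Prime 5)] : ((1 / 5 : ℚ) : ZMod 5) = 0 := by
  have h : ((1 / 5 : ℚ) : ZMod 5) = ((5 : ℕ) : ZMod 5)⁻¹ := by
    rw [one_div]
    exact_mod_cast Rat.cast_inv_nat (α := ZMod 5) 5
  rw [h, ZMod.natCast_self, inv_zero]

/-! ### Non-vacuity of the repaired binder: 37a1

The curve is written as the literal `⟨0, 0, 1, -1, 0⟩` throughout (no auxiliary `def`, so that
this theorem-only file stays kernel-reviewed); `[IsElliptic]` is taken as an instance hypothesis
where `j` needs it and discharged by `isElliptic_thirtySevenA1`. -/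

/-- `Δ(37a1) = 37` for `y² + y = x³ − x = [0,0,1,−1,0]`. [folklore] -/
theorem Δ_thirtySevenA1 : (⟨0, 0, 1, -1, 0⟩ : WeierstrassCurve ℚ).Δ = 37 := by
  simp only [WeierstrassCurve.Δ, WeierstrassCurve.b₂, WeierstrassCurve.b₄, WeierstrassCurve.b₆,
    WeierstrassCurve.b₈]
  norm_num

/-- `c₄(37a1) = 48`. [folklore] -/
theorem c₄_thirtySevenA1 : (⟨0, 0, 1, -1, 0⟩ : WeierstrassCurve ℚ).c₄ = 48 := by
  simp only [WeierstrassCurve.c₄, WeierstrassCurve.b₂, WeierstrassCurve.b₄]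
  norm_num

/-- 37a1 is an elliptic curve (`Δ = 37 ≠ 0`). [folklore] -/
theorem isElliptic_thirtySevenA1 : (⟨0, 0, 1, -1, 0⟩ : WeierstrassCurve ℚ).IsElliptic :=
  ⟨by rw [Δ_thirtySevenA1]; exact isUnit_iff_ne_zero.mpr (by norm_num)⟩

/-- The integral model `[0,0,1,−1,0]` base-changes to the rational one. [folklore] -/
theorem baseChange_thirtySevenA1 :
    ((⟨0, 0, 1, -1, 0⟩ : WeierstrassCurve ℤ).baseChange ℚ) = (⟨0, 0, 1, -1, 0⟩ : WeierstrassCurve ℚ) := by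
  simp only [WeierstrassCurve.baseChange, WeierstrassCurve.map]
  ext <;> simp

/-- 37a1 is a global minimal model: `q¹² ∤ 37` for every prime `q` (Silverman AEC VII.1,
Remark 1.1). [folklore] -/
theorem isGloballyMinimal_thirtySevenA1 : (⟨0, 0, 1, -1, 0⟩ : WeierstrassCurve ℚ).IsGloballyMinimal := by
  rw [← baseChange_thirtySevenA1]
  refine isGloballyMinimal_of_forall_isMinimalAt_int _ fun v ↦ ?_
  refine isMinimalAt_baseChange_int_of_not_pow_dvd_Δ ?_
  intro h
  have hΔ : (⟨0, 0, 1, -1, 0⟩ : WeierstrassCurve ℤ).Δ = 37 := by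
    simp only [WeierstrassCurve.Δ, WeierstrassCurve.b₂, WeierstrassCurve.b₄, WeierstrassCurve.b₆,
      WeierstrassCurve.b₈]
    norm_num
  rw [hΔ] at h
  have hp := Rat.HeightOneSpectrum.prime_natGenerator v
  have h' : Rat.HeightOneSpectrum.natGenerator v ^ 12 ∣ 37 := by exact_mod_cast h
  have hle : Rat.HeightOneSpectrum.natGenerator v ^ 12 ≤ 37 := Nat.le_of_dvd (by norm_num) h'
  have hge : 2 ^ 12 ≤ Rat.HeightOneSpectrum.natGenerator v ^ 12 := Nat.pow_le_pow_left hp.two_le 12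
  have := hge.trans hle
  norm_num at this

/-- `j(37a1) = 37⁻¹ · 48³ = 110592/37`, cast into `ℚ₃₇`. [folklore] -/
theorem j_cast_thirtySevenA1 [Fact (Nat.Prime 37)] [(⟨0, 0, 1, -1, 0⟩ : WeierstrassCurve ℚ).IsElliptic] :
    ((⟨0, 0, 1, -1, 0⟩ : WeierstrassCurve ℚ).j : ℚ_[37]) = (37 : ℚ_[37])⁻¹ * 48 ^ 3 := by
  rw [WeierstrassCurve.j, Units.val_inv_eq_inv_val, WeierstrassCurve.coe_Δ', Δ_thirtySevenA1,
    c₄_thirtySevenA1]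
  push_cast
  ring

/-- `‖j(37a1)‖₃₇ = 37 > 1`: the `j`-invariant `2¹²·3³/37` is not `37`-integral (multiplicative
reduction at `37`). [folklore] -/
theorem one_lt_norm_j_thirtySevenA1 [Fact (Nat.Prime 37)]
    [(⟨0, 0, 1, -1, 0⟩ : WeierstrassCurve ℚ).IsElliptic] :
    1 < ‖((⟨0, 0, 1, -1, 0⟩ : WeierstrassCurve ℚ).j : ℚ_[37])‖ := by
  rw [j_cast_thirtySevenA1, norm_mul, norm_inv, norm_pow]
  have h37 : ‖(37 : ℚ_[37])‖ = (37 : ℝ)⁻¹ := by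
    have h := @Padic.norm_p 37 _
    exact_mod_cast h
  have h48 : ‖(48 : ℚ_[37])‖ = 1 := by
    have hle : ‖((48 : ℤ) : ℚ_[37])‖ ≤ 1 := Padic.norm_int_le_one 48
    have hlt : ¬ ‖((48 : ℤ) : ℚ_[37])‖ < 1 := by
      rw [Padic.norm_intCast_lt_one_iff]; norm_num
    push_cast at hle hlt
    exact le_antisymm hle (not_lt.mp hlt)
  rw [h37, h48]
  norm_num

/-- 37a1 has no complex multiplication: `‖j‖₃₇ > 1` and CM `j`-invariants over `ℚ` are integers
(tree theorem `WeierstrassCurve.not_hasCM_of_one_lt_norm_j`; Silverman ATAEC Thm. II.6.1).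
[folklore] -/
theorem not_hasCM_thirtySevenA1 [(⟨0, 0, 1, -1, 0⟩ : WeierstrassCurve ℚ).IsElliptic] :
    ¬ (⟨0, 0, 1, -1, 0⟩ : WeierstrassCurve ℚ).HasCM := by
  haveI : Fact (Nat.Prime 37) := ⟨by norm_num⟩
  exact WeierstrassCurve.not_hasCM_of_one_lt_norm_j _ one_lt_norm_j_thirtySevenA1

/-- NON-VACUITY of `TamePinchR`'s binder after the rev-6 repair: there is an elliptic, globally
minimal, NON-CM Weierstrass curve over `ℚ` (37a1 = `[0,0,1,−1,0]`), so the new hypothesis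
`¬ W.HasCM` excludes the refuted CM witness 32a2 without emptying the `∀ W`. [folklore] -/
theorem hypotheses_satisfiable :
    ∃ (W : WeierstrassCurve ℚ) (_ : W.IsElliptic) (_ : W.IsGloballyMinimal), ¬ W.HasCM := by
  haveI := isElliptic_thirtySevenA1
  exact ⟨⟨0, 0, 1, -1, 0⟩, inferInstance, isGloballyMinimal_thirtySevenA1, not_hasCM_thirtySevenA1⟩

/-- The pointwise content of `TamePinchR` at 37a1 (Mordell–Weil rank `1` in print, Cremona's
tables): specialising the crux there yields an admissible prime — good ordinary `p ≥ 5` with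
`ρ̄_{E,p}` onto `GL₂(𝔽_p)` — for this explicit non-CM curve (true in print for every `p ≥ 5` of
good ordinary reduction, 37a1 being semistable with no isogeny; not a tree theorem). [folklore] -/
theorem exists_admissible_thirtySevenA1_of_tamePinchR (h : LeadingTerm.TamePinchR) :
    ∃ (p : ℕ) (_ : Fact p.Prime), 5 ≤ p ∧
      @IsOrdinaryAt (⟨0, 0, 1, -1, 0⟩ : WeierstrassCurve ℚ) isGloballyMinimal_thirtySevenA1 p _ ∧
      (⟨0, 0, 1, -1, 0⟩ : WeierstrassCurve ℚ).HasSurjectiveModNGaloisRep (p : ℤ) := by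
  haveI := isElliptic_thirtySevenA1
  haveI := isGloballyMinimal_thirtySevenA1
  obtain ⟨p, hp, h5, hord, hsurj, -⟩ := h ⟨0, 0, 1, -1, 0⟩ not_hasCM_thirtySevenA1
  exact ⟨p, hp, h5, hord, hsurj⟩

end Summit.BirchSwinnertonDyer.BirchSwinnertonDyer.Theorems.TamePinchR.Negative

end
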